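import Literature.NumberTheory.Automorphic.BrandtLatticeRingCongruence
import Literature.NumberTheory.Automorphic.BrandtEigenAugmentation
import Literature.RingTheory.CompleteIntersection.CotangentFitting
import HarnessLib

/-!
# The lattice congruence number `ξ` divides `12 ×` the congruence ideal of the eigen-augmentation

Requested by the crux programme of route `ABC/DefiniteXi` (items stmt-ABC-15023 `EisensteinQuarantine`,
stmt-ABC-11336 `XiBound`, stmt-ABC-11337 `XiStrongBound`): the closing link of the chain
**lattice ∣ ring ∣ cotangent** for a Brandt eigen-line.  Let `S` be a Brandt setup of type `(N⁺, N⁻)`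
(`Brandt.XiSetup`), `λ` an eigenvalue system whose eigen-lattice (Brandt matrices `B(p)`, primes
`p ∤ N⁺N⁻`) is the line `ℤ φ`, `φ ≠ 0`, `π_φ : 𝕋⁰(S) →ₐ[ℤ] ℤ` the eigen-augmentation of the anemic
integral Brandt–Hecke algebra (`Brandt.XiSetup.eigenAugmentation`, file `BrandtEigenAugmentation`), and
`η = π_φ(Ann_{𝕋⁰}(ker π_φ)) ⊆ ℤ` its congruence ideal
(`Literature.RingTheory.CompleteIntersection.congruenceIdeal`).  Then the congruence number
`ξ = S.xi λ = Σ w_i φ_i²` of Pollack–Weston satisfies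

* `Brandt.XiSetup.xi_dvd_twelve_mul_eigenAugmentation` — `ξ ∣ 12 · π_φ(x)` for every
  `x ∈ Ann_{𝕋⁰}(ker π_φ)` (the tree's `xi_dvd_twelve_mul_of_mul_sub_eq_zero`, with its matrix hypotheses
  discharged by `mem_annihilator_ker_iff` and `eigenAugmentation_spec`);
* `Brandt.XiSetup.xi_dvd_twelve_mul_of_mem_congruenceIdeal` — **`ξ ∣ 12 η`**: `ξ ∣ 12 m` for every `m ∈ η`;
* `Brandt.XiSetup.xi_dvd_twelve_mul_of_mem_fittingIdeal_cotangent` — **`ξ ∣ 12 · Fit₀(ker π_φ / (ker π_φ)²)`**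
  (de Smit–Rubin–Schoof / Lenstra `Fit_O(I/I²) ⊆ η`, tree theorem
  `fittingIdeal_cotangentModule_le_congruenceIdeal`, applied to `id : 𝕋⁰ → 𝕋⁰`; `ker π_φ` is finitely
  generated because `𝕋⁰(S) ⊆ M_h(ℤ)` is Noetherian).

So any upper bound on the `ℓ`-adic size of ONE element of the Fitting ideal of the cotangent module of
`𝕋⁰(S)` at the eigen-line bounds `ordProj[ℓ] ξ` up to the factor `12` (the l.c.m. of the weights
`w_i = |O_iˣ|/2 ∣ 12`) — the form in which Eisenstein-quarantine statements about `ξ` become statements of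
commutative algebra about the Hecke algebra (Pollack–Weston 2011 §2.2: `ξ` vs. `η_f(N⁺,N⁻)`; Diamond 1997,
de Smit–Rubin–Schoof 1997 for `Fit`/`η`).  The factor `12` is genuinely needed at `ℓ = 2, 3` (classes with
`w_i = 2, 3` exist); no claim of equality `ξ = η` (which needs Gorenstein/freeness, false in general at
Eisenstein `ℓ = 2`, Calegari–Emerton 2005) is made.  Everything here is proved; no definitions, no named facts.

## References

* R. Pollack, T. Weston, *On anticyclotomic μ-invariants of modular forms*, Compos. Math. 147 (2011),
  §2.1–2.2. [PollackWeston2011]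
* B. de Smit, K. Rubin, R. Schoof, *Criteria for complete intersections*, in: Modular Forms and Fermat's
  Last Theorem, Springer 1997, Prop. 1.1 and §3 (p. 353). [DeSmitRubinSchoof1997]
* F. Diamond, *The Taylor–Wiles construction and multiplicity one*, Invent. Math. 128 (1997). [Diamond1997]
-/

noncomputable section

open scoped Matrix

namespace Literature.NumberTheory.Automorphic

namespace Brandt

namespace XiSetup

open Literature.RingTheory.CompleteIntersection Literature.RingTheory.FittingIdeal

variable {Nplus Nminus : ℕ} (S : XiSetup Nplus Nminus) [Fintype (ClassSet S.O)]
variable (lam : ℕ → ℤ) {φ : ClassSet S.O → ℤ}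

open scoped Classical in
/-- **`ξ ∣ 12 · π_φ(x)` for every annihilator `x` of the augmentation ideal.**  If `x ∈ 𝕋⁰(S)` kills
`ker π_φ`, then `x · (B(p) − λ(p)) = 0` for all primes `p ∤ N⁺N⁻` (`mem_annihilator_ker_iff`) and
`x φ = π_φ(x) φ` (`eigenAugmentation_spec`), so the lattice theorem
`xi_dvd_twelve_mul_of_mul_sub_eq_zero` applies with `D = π_φ(x)`. [cite: PollackWeston2011, §2.1–2.2] -/
theorem xi_dvd_twelve_mul_eigenAugmentation (hφ : φ ≠ 0)
    (hL : eigenLattice (Nplus * Nminus) (Brandt.matrix S.O) lam = ℤ ∙ φ)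
    {x : S.heckeAlgebra} (hx : x ∈ (RingHom.ker (S.eigenAugmentation lam hφ hL)).annihilator) :
    (S.xi lam : ℤ) ∣ 12 * S.eigenAugmentation lam hφ hL x := by
  have hkill := (S.mem_annihilator_ker_iff lam hφ hL).mp hx
  have hM : (x : Matrix (ClassSet S.O) (ClassSet S.O) ℤ) ∈
      Algebra.adjoin ℤ {X : Matrix (ClassSet S.O) (ClassSet S.O) ℤ |
        ∃ p : ℕ, p.Prime ∧ ¬ p ∣ Nplus * Nminus ∧ X = Brandt.matrix S.O p} := by
    rw [← heckeAlgebra_def]; exact x.2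
  exact S.xi_dvd_twelve_mul_of_mul_sub_eq_zero lam hφ hL hM hkill (S.eigenAugmentation_spec lam hφ hL x)

open scoped Classical in
/-- **`ξ ∣ 12 η`**: the lattice congruence number divides `12 m` for every element `m` of the congruence
ideal `η = π_φ(Ann_{𝕋⁰}(ker π_φ))` of the eigen-augmentation (every `m ∈ η` is `π_φ(x)` for an
annihilator `x`, `mem_congruenceIdeal_iff`). [cite: PollackWeston2011, §2.1–2.2] -/
theorem xi_dvd_twelve_mul_of_mem_congruenceIdeal (hφ : φ ≠ 0)
    (hL : eigenLattice (Nplus * Nminus) (Brandt.matrix S.O) lam = ℤ ∙ φ)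
    {m : ℤ} (hm : m ∈ congruenceIdeal (S.eigenAugmentation lam hφ hL)) :
    (S.xi lam : ℤ) ∣ 12 * m := by
  obtain ⟨x, hx, rfl⟩ := (mem_congruenceIdeal_iff _).mp hm
  exact S.xi_dvd_twelve_mul_eigenAugmentation lam hφ hL hx

open scoped Classical in
/-- **`ξ ∣ 12 · Fit₀(ker π_φ / (ker π_φ)²)`**: the lattice congruence number divides `12 m` for every
element `m` of the zeroth Fitting ideal over `ℤ` of the cotangent module of the augmentation ideal —
de Smit–Rubin–Schoof's `Fit_O(I_T/I_T²) ⊆ η_T` (tree: `fittingIdeal_cotangentModule_le_congruenceIdeal`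
for the identity surjection `𝕋⁰ → 𝕋⁰`; `ker π_φ` is finitely generated since `𝕋⁰(S)` is Noetherian)
composed with `ξ ∣ 12 η`. [cite: DeSmitRubinSchoof1997, §3, proof of Criterion I, p. 353] -/
theorem xi_dvd_twelve_mul_of_mem_fittingIdeal_cotangent (hφ : φ ≠ 0)
    (hL : eigenLattice (Nplus * Nminus) (Brandt.matrix S.O) lam = ℤ ∙ φ)
    {m : ℤ} (hm : m ∈ Module.fittingIdeal ℤ (CotangentModule (S.eigenAugmentation lam hφ hL)) 0) :
    (S.xi lam : ℤ) ∣ 12 * m := by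
  have hle := fittingIdeal_cotangentModule_le_congruenceIdeal
    (AlgHom.id ℤ S.heckeAlgebra) (S.eigenAugmentation lam hφ hL) (fun y => ⟨y, rfl⟩)
    (IsNoetherian.noetherian _)
  exact S.xi_dvd_twelve_mul_of_mem_congruenceIdeal lam hφ hL (hle hm)

open scoped Classical in
/-- `ξ ∣ 12 η` in `ℕ`: `ξ ∣ 12 |m|` for every `m` in the congruence ideal (the form consumed by bounds on
`ordProj[ℓ] ξ`). [folklore] -/
theorem xi_dvd_twelve_mul_natAbs_of_mem_congruenceIdeal (hφ : φ ≠ 0)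
    (hL : eigenLattice (Nplus * Nminus) (Brandt.matrix S.O) lam = ℤ ∙ φ)
    {m : ℤ} (hm : m ∈ congruenceIdeal (S.eigenAugmentation lam hφ hL)) :
    S.xi lam ∣ 12 * m.natAbs := by
  have h := Int.natAbs_dvd_natAbs.mpr (S.xi_dvd_twelve_mul_of_mem_congruenceIdeal lam hφ hL hm)
  simpa [Int.natAbs_mul, Int.natAbs_natCast] using h

end XiSetup

end Brandt

end Literature.NumberTheory.Automorphic

end
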